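import Literature.NumberTheory.GaloisRepresentations.DegreeOnePrimesFrobeniusRel
import Literature.NumberTheory.LFunctions.PrimeIdealChebyshev
import Mathlib.FieldTheory.Finite.Basic
import HarnessLib

/-!
# Frobenius fixed points and degree-one primes of an intermediate field

Topic `Literature/NumberTheory/GaloisRepresentations`; namespace
`Literature.NumberTheory.GaloisRepresentations` (that of `FrobeniusDensityTheorem.lean`, whose
Frobenius / splitting dictionary this file continues).  Everything here is PROVED (theorems only,
nothing is defined, no named fact).

Let `L/M` be a finite Galois extension of number fields with group `G`, `E` an intermediate field
with `H = Gal(L/E) ≤ G`, `q` a prime of `M` unramified in `L`, `Q ∣ q` a prime of `L` and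
`φ = Frob_Q ∈ G` its (arithmetic) Frobenius.  The classical dictionary between the cycle
structure of `φ` on `G/H` and the splitting of `q` in `E` (Marcus, *Number Fields*, Ch. 4,
Thm. 33; Neukirch I §9) contains in particular:

* `mem_zpowers_of_smul_eq` — **the decomposition group of an unramified prime is generated by
  its Frobenius**: `t • Q = Q ⇒ t ∈ ⟨φ⟩` (the residue extension is generated by Frobenius,
  Mathlib `FiniteField.bijective_frobeniusAlgEquivOfAlgebraic_pow`, and the inertia group is
  trivial, the tree's `inertia_eq_bot_of_isUnramifiedIn`);
* `card_quotient_under_inv_smul_eq` — if `y⁻¹ φ y ∈ H` then the prime `(y⁻¹ Q) ∩ 𝓞_E` of `E`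
  has residue degree one over `q` (`N((y⁻¹Q) ∩ 𝓞_E) = N(q)`; the tree's
  `inertiaDeg_under_eq_one_of_mem_fixingSubgroup`);
* `inv_mul_mem_fixingSubgroup_of_under_eq` — the fibres of `y ↦ (y⁻¹ Q) ∩ 𝓞_E` on
  `{y : y⁻¹ φ y ∈ H}` are single left `H`-cosets;
* `card_conj_mem_fixingSubgroup_le` — hence **`#{y ∈ G : y⁻¹ φ y ∈ H} ≤ #H · #{𝔓 ⊆ 𝓞_E prime :
  N𝔓 = N q}`**: the number of fixed points of `Frob_q` on `G/H` is at most the number of primes of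
  `E` of norm `N q` (in fact equal to the number of degree-one primes of `E` above `q`, Marcus
  Thm. 33; only the inequality is needed and proved).

This is the input through which the prime ideal theorem for `E` bounds from above the natural
density of the primes `q` whose Frobenius class meets `H` with many fixed points (used for the
density of supersingular primes, `EllipticCurves/SupersingularDensity*`).

## References

* D. A. Marcus, *Number Fields*, 2nd ed., Springer 2018, Ch. 4, Thm. 33 (splitting of `q` in an
  intermediate field from the cycle structure of Frobenius) and Thm. 28 (decomposition and inertia
  groups). [Marcus2018]
* J. Neukirch, *Algebraic Number Theory*, Springer 1999, Ch. I §9, Prop. (9.4)–(9.6).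
  [NeukirchANT1999]
-/

noncomputable section

open NumberField IsDedekindDomain

open scoped Classical Pointwise

namespace Literature.NumberTheory.GaloisRepresentations

variable {M L : Type*} [Field M] [Field L] [NumberField M] [NumberField L] [Algebra M L]
  [IsGalois M L]

/-! ### The decomposition group of an unramified prime is generated by Frobenius -/

/-- **`D(Q|q) = ⟨Frob_Q⟩` at an unramified prime.**  If `q` is unramified in the Galois
extension `L/M`, `Q ∣ q` and `φ` is an arithmetic Frobenius at `Q`, then every `t ∈ Gal(L/M)`
with `t • Q = Q` is a power of `φ`: the automorphism of the residue field `𝓞_L/Q` induced by `t`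
is a power `Frob^n` of the Frobenius of the finite extension `(𝓞_L/Q)/(𝓞_M/q)` (Mathlib
`FiniteField.bijective_frobeniusAlgEquivOfAlgebraic_pow`), so `t φ^{-n}` lies in the inertia
group, which is trivial (Marcus, Ch. 4, Thm. 28 and the Corollary "`D/E` is cyclic of order `f`"
with `e = 1`). [cite: Marcus2018, Ch. 4, Thm. 28] -/
theorem mem_zpowers_of_smul_eq {q : HeightOneSpectrum (𝓞 M)}
    (hunr : Algebra.IsUnramifiedIn (𝓞 L) q.asIdeal) {Q : Ideal (𝓞 L)}
    (hQ : Q ∈ q.asIdeal.primesOver (𝓞 L)) {φ : L ≃ₐ[M] L} (hφ : IsArithFrobAt (𝓞 M) φ Q)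
    {t : L ≃ₐ[M] L} (ht : t • Q = Q) : t ∈ Subgroup.zpowers φ := by
  haveI := hQ.1
  haveI := hQ.2
  have hQne : Q ≠ ⊥ := Ideal.ne_bot_of_mem_primesOver q.ne_bot hQ
  haveI : Q.IsMaximal := hQ.1.isMaximal hQne
  haveI : q.asIdeal.IsMaximal := q.isMaximal
  letI : Field (𝓞 M ⧸ q.asIdeal) := Ideal.Quotient.field _
  letI : Field (𝓞 L ⧸ Q) := Ideal.Quotient.field _
  haveI : Finite (𝓞 M ⧸ q.asIdeal) := Ideal.finiteQuotientOfFreeOfNeBot _ q.ne_bot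
  haveI : Finite (𝓞 L ⧸ Q) := Ideal.finiteQuotientOfFreeOfNeBot Q hQne
  letI : Fintype (𝓞 M ⧸ q.asIdeal) := Fintype.ofFinite _
  haveI : Algebra.IsAlgebraic (𝓞 M ⧸ q.asIdeal) (𝓞 L ⧸ Q) := Algebra.IsAlgebraic.of_finite _ _
  let sH := Ideal.Quotient.stabilizerHom Q q.asIdeal (L ≃ₐ[M] L)
  let T : MulAction.stabilizer (L ≃ₐ[M] L) Q := ⟨t, ht⟩
  let F : MulAction.stabilizer (L ≃ₐ[M] L) Q := ⟨φ, hφ.mem_stabilizer⟩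
  -- the Frobenius `φ` induces the Frobenius of the residue field extension
  have hN : Nat.card (𝓞 M ⧸ Q.under (𝓞 M)) = Fintype.card (𝓞 M ⧸ q.asIdeal) := by
    rw [← hQ.2.over, Nat.card_eq_fintype_card]
  have hFrob : sH F = FiniteField.frobeniusAlgEquivOfAlgebraic (𝓞 M ⧸ q.asIdeal) (𝓞 L ⧸ Q) := by
    apply AlgEquiv.ext
    intro x
    obtain ⟨x, rfl⟩ := Ideal.Quotient.mk_surjective x
    rw [Ideal.Quotient.stabilizerHom_apply, FiniteField.frobeniusAlgEquivOfAlgebraic_apply]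
    have h1 := hφ x
    rw [MulSemiringAction.toAlgHom_apply, hN] at h1
    rw [← map_pow, Ideal.Quotient.eq]
    exact h1
  -- every automorphism of the residue extension is a power of Frobenius
  obtain ⟨⟨n, _⟩, hn⟩ :=
    (FiniteField.bijective_frobeniusAlgEquivOfAlgebraic_pow (𝓞 M ⧸ q.asIdeal) (𝓞 L ⧸ Q)).2 (sH T)
  simp only at hn
  rw [← hFrob, ← map_pow] at hn
  -- so `T⁻¹ F^n` acts trivially on the residue field, i.e. lies in the (trivial) inertia group
  have hker : T⁻¹ * F ^ n ∈ sH.ker := by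
    rw [MonoidHom.mem_ker, map_mul, map_inv, hn, inv_mul_cancel]
  rw [Ideal.Quotient.ker_stabilizerHom] at hker
  have hG : ((T⁻¹ * F ^ n : MulAction.stabilizer (L ≃ₐ[M] L) Q) : L ≃ₐ[M] L) ∈
      Q.inertia (L ≃ₐ[M] L) := AddSubgroup.coe_mem_inertia.mpr hker
  rw [inertia_eq_bot_of_isUnramifiedIn hunr hQ, Subgroup.mem_bot] at hG
  have ht' : t = φ ^ n := by
    have h1 : ((T⁻¹ * F ^ n : MulAction.stabilizer (L ≃ₐ[M] L) Q) : L ≃ₐ[M] L) = t⁻¹ * φ ^ n := by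
      simp [T, F]
    rw [h1, inv_mul_eq_one] at hG
    exact hG
  rw [ht']
  exact Subgroup.npow_mem_zpowers φ n

/-! ### Primes of an intermediate field below the conjugates of `Q` -/

variable (E : IntermediateField M L)

/-- **A fixed point `yH` of Frobenius gives a degree-one prime of `E = L^H`.**  If
`y⁻¹ φ y ∈ Gal(L/E)` (i.e. `φ` fixes the coset `y · Gal(L/E)`), then the prime `(y⁻¹ Q) ∩ 𝓞_E`
of `E` has the same residue field cardinality as `q`: `N((y⁻¹Q) ∩ 𝓞_E) = N(q)` (the Frobenius of
`y⁻¹ Q` is `y⁻¹ φ y`, which fixes `E`; the tree's `inertiaDeg_under_eq_one_of_mem_fixingSubgroup`;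
Marcus, Ch. 4, Thm. 33). [cite: Marcus2018, Ch. 4, Thm. 33] -/
theorem card_quotient_under_inv_smul_eq {q : HeightOneSpectrum (𝓞 M)} {Q : Ideal (𝓞 L)}
    (hQ : Q ∈ q.asIdeal.primesOver (𝓞 L)) {φ : L ≃ₐ[M] L} (hφ : IsArithFrobAt (𝓞 M) φ Q)
    {y : L ≃ₐ[M] L} (hy : y⁻¹ * φ * y ∈ E.fixingSubgroup) :
    Nat.card (𝓞 E ⧸ (y⁻¹ • Q).under (𝓞 E)) = Nat.card (𝓞 M ⧸ q.asIdeal) := by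
  have hQ' : y⁻¹ • Q ∈ q.asIdeal.primesOver (𝓞 L) :=
    DegreeOnePrimesRel.smul_mem_primesOver hQ y⁻¹
  have hφ' : IsArithFrobAt (𝓞 M) (y⁻¹ * φ * y) (y⁻¹ • Q) := by
    simpa using hφ.conj y⁻¹
  exact card_quotient_under_eq_of_inertiaDeg_eq_one E hQ'
    (inertiaDeg_under_eq_one_of_mem_fixingSubgroup E hQ' hφ' hy)

/-- The same statement for absolute norms: `N((y⁻¹Q) ∩ 𝓞_E) = N(q)`. [cite: Marcus2018, Ch. 4, Thm. 33] -/
theorem absNorm_under_inv_smul_eq [NumberField E] {q : HeightOneSpectrum (𝓞 M)}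
    {Q : Ideal (𝓞 L)} (hQ : Q ∈ q.asIdeal.primesOver (𝓞 L)) {φ : L ≃ₐ[M] L}
    (hφ : IsArithFrobAt (𝓞 M) φ Q) {y : L ≃ₐ[M] L} (hy : y⁻¹ * φ * y ∈ E.fixingSubgroup) :
    Ideal.absNorm ((y⁻¹ • Q).under (𝓞 E)) = Ideal.absNorm q.asIdeal := by
  rw [Ideal.absNorm_apply, Ideal.absNorm_apply, Submodule.cardQuot_apply,
    Submodule.cardQuot_apply]
  exact card_quotient_under_inv_smul_eq E hQ hφ hy

omit [NumberField M] [NumberField L] [IsGalois M L] in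
/-- The Galois action of `Gal(L/E)` on the ideals of `𝓞_L` is the restriction of that of
`Gal(L/M)`. [folklore] -/
theorem restrictScalars_smul_ideal (ψ : L ≃ₐ[E] L) (Q : Ideal (𝓞 L)) :
    (ψ.restrictScalars M) • Q = ψ • Q := by
  ext x
  rw [Ideal.mem_pointwise_smul_iff_inv_smul_mem, Ideal.mem_pointwise_smul_iff_inv_smul_mem]
  have h : (ψ.restrictScalars M)⁻¹ = (ψ⁻¹).restrictScalars M := rfl
  rw [h, RingOfIntegers.restrictScalars_smul]

/-- **The fibres of `y ↦ (y⁻¹Q) ∩ 𝓞_E` are left cosets of `H = Gal(L/E)`.**  Let `q` be unramified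
in `L`, `Q ∣ q` with Frobenius `φ`, and `y, y'` with `y⁻¹ φ y ∈ H`.  If `(y⁻¹ Q) ∩ 𝓞_E = (y'⁻¹ Q) ∩ 𝓞_E`
then `y⁻¹ y' ∈ H`: the two primes `y⁻¹Q`, `y'⁻¹Q` of `L` lie over the same prime of `E`, so
`y'⁻¹ Q = h y⁻¹ Q` for some `h ∈ H` (transitivity of `Gal(L/E)` on the primes above it); then
`t = y' h y⁻¹` stabilises `Q`, hence `t = φⁿ` (`mem_zpowers_of_smul_eq`), and
`y⁻¹ y' = (y⁻¹ φ y)ⁿ h⁻¹ ∈ H`.  (This is the injectivity half of Marcus, Ch. 4, Thm. 33: distinct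
fixed cosets of Frobenius on `G/H` give distinct degree-one primes of `E`.) [cite: Marcus2018, Ch. 4, Thm. 33] -/
theorem inv_mul_mem_fixingSubgroup_of_under_eq {q : HeightOneSpectrum (𝓞 M)}
    (hunr : Algebra.IsUnramifiedIn (𝓞 L) q.asIdeal) {Q : Ideal (𝓞 L)}
    (hQ : Q ∈ q.asIdeal.primesOver (𝓞 L)) {φ : L ≃ₐ[M] L} (hφ : IsArithFrobAt (𝓞 M) φ Q)
    {y y' : L ≃ₐ[M] L} (hy : y⁻¹ * φ * y ∈ E.fixingSubgroup)
    (h : (y⁻¹ • Q).under (𝓞 E) = (y'⁻¹ • Q).under (𝓞 E)) : y⁻¹ * y' ∈ E.fixingSubgroup := by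
  haveI : NumberField E := NumberField.of_module_finite M E
  haveI := hQ.1
  haveI := hQ.2
  have hQne : Q ≠ ⊥ := Ideal.ne_bot_of_mem_primesOver q.ne_bot hQ
  -- the two primes of `L` over the prime `P` of `E`
  set P : Ideal (𝓞 E) := (y⁻¹ • Q).under (𝓞 E) with hP
  haveI : (y⁻¹ • Q).IsPrime := inferInstance
  haveI : (y'⁻¹ • Q).IsPrime := inferInstance
  haveI : P.IsPrime := Ideal.IsPrime.under (𝓞 E) (y⁻¹ • Q)
  haveI h1 : (y⁻¹ • Q).LiesOver P := ⟨rfl⟩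
  haveI h2 : (y'⁻¹ • Q).LiesOver P := ⟨h⟩
  haveI : IsGaloisGroup (L ≃ₐ[E] L) (𝓞 E) (𝓞 L) := IsGaloisGroup.of_isFractionRing _ _ _ E L
  obtain ⟨ψ, hψ⟩ := Ideal.exists_smul_eq_of_isGaloisGroup P (y⁻¹ • Q) (y'⁻¹ • Q) (L ≃ₐ[E] L)
  -- `h₀ = ψ`, seen in `Gal(L/M)`, lies in `H` and moves `y⁻¹Q` to `y'⁻¹Q`
  set h₀ : L ≃ₐ[M] L := ψ.restrictScalars M with hh₀
  have hh₀H : h₀ ∈ E.fixingSubgroup := by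
    rw [IntermediateField.mem_fixingSubgroup_iff]
    intro x hx
    exact ψ.commutes ⟨x, hx⟩
  have hsmul : h₀ • (y⁻¹ • Q) = y'⁻¹ • Q := by rw [hh₀, restrictScalars_smul_ideal, hψ]
  -- `t = y' h₀ y⁻¹` stabilises `Q`
  have ht : (y' * h₀ * y⁻¹) • Q = Q := by
    rw [mul_smul, mul_smul, hsmul, smul_inv_smul]
  obtain ⟨n, hn⟩ := Subgroup.mem_zpowers_iff.mp (mem_zpowers_of_smul_eq hunr hQ hφ ht)
  -- `y⁻¹ y' = (y⁻¹ φ y)^n h₀⁻¹`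
  have key : y⁻¹ * y' = (y⁻¹ * φ * y) ^ n * h₀⁻¹ := by
    have h1 : (y⁻¹ * φ * y) ^ n = y⁻¹ * φ ^ n * y := by
      have := (conj_zpow (i := n) (a := y⁻¹) (b := φ))
      rwa [inv_inv] at this
    rw [h1, hn]
    group
  rw [key]
  exact mul_mem (zpow_mem hy n) (inv_mem hh₀H)

/-! ### Counting: fixed points of Frobenius on `G/H` versus primes of `E` of norm `N q` -/

/-- The prime `(y⁻¹ Q) ∩ 𝓞_E` is a nonzero prime of `𝓞_E`. [folklore] -/
theorem under_inv_smul_isPrime_ne_bot {q : HeightOneSpectrum (𝓞 M)} {Q : Ideal (𝓞 L)}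
    (hQ : Q ∈ q.asIdeal.primesOver (𝓞 L)) (y : L ≃ₐ[M] L) :
    ((y⁻¹ • Q).under (𝓞 E)).IsPrime ∧ (y⁻¹ • Q).under (𝓞 E) ≠ ⊥ := by
  have hQ' := DegreeOnePrimesRel.smul_mem_primesOver hQ y⁻¹
  haveI := hQ'.1
  have hmem := under_intermediateField_mem_primesOver E hQ'
  refine ⟨hmem.1, fun hbot ↦ q.ne_bot ?_⟩
  have h := hmem.2.over
  rw [hbot, Ideal.under_bot] at h
  exact h

/-- **Fixed points of Frobenius on `G/H` are bounded by the primes of `E` of norm `N q`.**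
For `q` unramified in the Galois extension `L/M` with group `G`, `Q ∣ q` with Frobenius `φ`, and an
intermediate field `E` with `H = Gal(L/E)`:
`#{y ∈ G : y⁻¹ φ y ∈ H} ≤ #H · #{𝔓 ⊆ 𝓞_E prime : N𝔓 = N q}`.
Indeed `y ↦ (y⁻¹Q) ∩ 𝓞_E` maps the left-hand set to primes of norm `N q`
(`absNorm_under_inv_smul_eq`) with fibres single left `H`-cosets
(`inv_mul_mem_fixingSubgroup_of_under_eq`).  (Marcus, Ch. 4, Thm. 33, gives the exact count of the
degree-one primes of `E` over `q` as the number of fixed points of `φ` on `G/H`; only this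
inequality is needed here.)  The right-hand count is the tree's `normPrimeIdealCount E (N q)`
(`LFunctions/PrimeIdealChebyshev.lean`). [cite: Marcus2018, Ch. 4, Thm. 33] -/
theorem card_conj_mem_fixingSubgroup_le [NumberField E] {q : HeightOneSpectrum (𝓞 M)}
    (hunr : Algebra.IsUnramifiedIn (𝓞 L) q.asIdeal) {Q : Ideal (𝓞 L)}
    (hQ : Q ∈ q.asIdeal.primesOver (𝓞 L)) {φ : L ≃ₐ[M] L} (hφ : IsArithFrobAt (𝓞 M) φ Q) :
    Nat.card {y : L ≃ₐ[M] L // y⁻¹ * φ * y ∈ E.fixingSubgroup} ≤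
      Nat.card E.fixingSubgroup *
        LFunctions.NumberField.normPrimeIdealCount E (Ideal.absNorm q.asIdeal) := by
  -- the target set of primes of `E`, finite, of cardinality `normPrimeIdealCount E (N q)`
  set T : Set (Ideal (𝓞 E)) :=
    {P | P.IsPrime ∧ P ≠ ⊥ ∧ Ideal.absNorm P = Ideal.absNorm q.asIdeal} with hT
  have hTfin : T.Finite := LFunctions.NumberField.finite_setOf_prime_absNorm_eq E _
  have hTcard : Nat.card T = LFunctions.NumberField.normPrimeIdealCount E (Ideal.absNorm q.asIdeal) := by
    rw [LFunctions.NumberField.normPrimeIdealCount, ← hT, Nat.card_coe_set_eq]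
  haveI : Finite T := hTfin.to_subtype
  -- the map `y ↦ (y⁻¹Q) ∩ 𝓞_E`
  set S := {y : L ≃ₐ[M] L // y⁻¹ * φ * y ∈ E.fixingSubgroup} with hS
  let f : S → T := fun y ↦ ⟨(y.1⁻¹ • Q).under (𝓞 E),
    (under_inv_smul_isPrime_ne_bot E hQ y.1).1, (under_inv_smul_isPrime_ne_bot E hQ y.1).2,
    absNorm_under_inv_smul_eq E hQ hφ y.2⟩
  -- a section of `f` over its image
  have hsec : ∀ P : Set.range f, ∃ y : S, f y = P.1 := fun P ↦ P.2
  choose g hg using hsec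
  -- the injection `S ↪ T × H`, `y ↦ (f y, (g (f y))⁻¹ y)`
  have hmemH : ∀ y : S, ((g ⟨f y, y, rfl⟩).1)⁻¹ * y.1 ∈ E.fixingSubgroup := by
    intro y
    refine inv_mul_mem_fixingSubgroup_of_under_eq E hunr hQ hφ (g ⟨f y, y, rfl⟩).2 ?_
    have h := hg ⟨f y, y, rfl⟩
    exact congrArg Subtype.val h
  let F : S → T × E.fixingSubgroup := fun y ↦ (f y, ⟨((g ⟨f y, y, rfl⟩).1)⁻¹ * y.1, hmemH y⟩)
  have hF : Function.Injective F := by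
    intro y₁ y₂ h
    simp only [F, Prod.mk.injEq, Subtype.mk.injEq] at h
    obtain ⟨h1, h2⟩ := h
    have h3 : (g ⟨f y₁, y₁, rfl⟩).1 = (g ⟨f y₂, y₂, rfl⟩).1 := by
      have : (⟨f y₁, y₁, rfl⟩ : Set.range f) = ⟨f y₂, y₂, rfl⟩ := Subtype.ext h1
      rw [this]
    rw [h3] at h2
    exact Subtype.ext (mul_left_cancel h2)
  haveI : Finite (T × E.fixingSubgroup) := inferInstance
  calc Nat.card S ≤ Nat.card (T × E.fixingSubgroup) := Nat.card_le_card_of_injective F hF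
    _ = Nat.card T * Nat.card E.fixingSubgroup := Nat.card_prod _ _
    _ = Nat.card E.fixingSubgroup *
          LFunctions.NumberField.normPrimeIdealCount E (Ideal.absNorm q.asIdeal) := by
        rw [hTcard, mul_comm]

end Literature.NumberTheory.GaloisRepresentations
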